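import Summits.QuantumFields.BalabanUV.Beta.GAN24.ExchangeSlotResum
import Summits.QuantumFields.BalabanUV.Beta.GAN24.StencilSlotOfShapes
import Summits.QuantumFields.BalabanUV.Beta.ChartConjugationReflection
import Summits.QuantumFields.BalabanUV.Beta.SpineRecursiveW

/-!
# `BalabanUV.Beta.GAN24.TwoFaceWordAdditive` — binder row G-an2-4 ∕ (CONV-C), W-slot CT-W, conservation law (C)∕(C)sym, the SECTOR SPLIT glue (S) of this lineage's note
# `HOME/b2b-balaban-gan24-formalise-leaf-04/g66/CSYM-LEVEL0-KERNEL-BLUEPRINT.md` §7: **THE TWO-FACE WORD `FF[(A ∘ X) ∘ C]` IS ADDITIVE IN EACH SLOT (localised slots, spread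
# middle kernel), AND THE LAGRANGIAN-CHART BACKGROUND DERIVATIVE OF THE DRESSED LEVEL-0 OPERATOR SPLITS INTO ITS WILSON, BORDER AND MULTIPLIER HALF-VERTICES
# `dM X̃♮ Lc S♮_0 M♮ = V^E + V^VH + V^M`**

NOT IN PRINT; OUR BOOKKEEPING ([folklore] BY NAME over an5's `TameKernelCalculus` (`comp_add_left∕right_tame`, `Loc ∕ Spr`), an2's `SecondOrderResponse.dM`, `ChartConjugationReflection.vertexOfK_add`,
leaf-06's `StencilSlotOfShapes.unitS_add`, an2's `SpineRecursiveW.SpureRecAt_zero_level`; G-an2-4 formalisation swarm, leaf prover `b2b-balaban-gan24-formalise-leaf-04`, gen 66).  HONEST FRAMING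
(cell contract, verbatim): «discharging `BetaPertH` makes Bałaban's UV stability UNCONDITIONAL — a real constructive-QFT result; it is NOT the continuum limit and NOT the Clay problem.»
HONEST DEPENDENCY (verbatim): «continuum YM on T⁴ ⇐ BetaPertH ∧ nine spine estimates (0/9 proved); BetaPertH ⇐ (D1) ∧ (D4) ∧ CAP+tail; G-an2-4 gates asym, D1 and NE2/3/4.»

WHY: `DressedSourceZeroModeWords.zmode_dressedSource_inl_inl` writes the ff zero mode of the dressed source as `Σ_{u∈box}Σ'_{u′}` of the two exchange words `FF[(dM_b ∘ X̃♮) ∘ dM_{b′}]` (+ the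
`K·W·K` word); the sector files 18 ∕ 20 ∕ 23 ∕ 24 ∕ 26 ∕ 27 ∕ 28 evaluate the words SECTOR BY SECTOR.  This file supplies the two pieces of glue between them: the word is additive in each
slot (so `FF[((V^E+V^VH+V^M) ∘ X̃♮) ∘ (V^E+V^VH+V^M)]` is the sum of the nine sector words, bond by bond), and `dM` at the level-0 tables IS that three-term sum.

WHAT ([folklore]; generic `d`; 0 `def`, 0 cited facts, 0 `def … : Prop`, 0 sorry): §1 `summable_twoFace_of_biLoc ∕ _of_loc` (a localised kernel's face-weighted pair family is summable),
**`tsum_twoFace_add ∕ _sub ∕ _neg`**; §2 **`twoFace_word_add_left ∕ _add_right`** (`FF[((A + B) ∘ X) ∘ C] = FF[(A ∘ X) ∘ C] + FF[(B ∘ X) ∘ C]` and the right-slot twin, for `Loc A B C`,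
`Spr X`); §3 `abs_unitS_le_of_locStencil` (a local stencil family in units is bounded), **`dM_unitS_add`** (`dM K N (unitS s_f s_m (S + T)) M = vertexOfK K N (unitS S) + dM K N (unitS T) M`,
decaying `K`, local `S T`), **`dM_dressed_level0_split`** (in-block root, `1 ≤ Lc`, level 0, any `M`:
`dM X̃♮_0 Lc (unitS s_f s_m (SpureRecAt d Lc ρ cE cVH cΛ 0)) M μ u = V^E_{μ,u} + (V^VH_{μ,u} + vertexOfM X̃♮_0 Lc M μ u)`).  Asserts NO value of Bałaban's tables; discharges NOTHING of
(C)sym ∕ (Q-D) ∕ (Q-D-rate) ∕ «T2Shape» ∕ «T2Drift» ∕ (hW, hWall); NEVER «G-an2-4 closed» as (CONV-C); NOT D1, NOT `BetaPertH`, NOT continuum, NOT Clay.  2026-08-23; no existing file touched.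
-/

noncomputable section

open Finset
open scoped BigOperators
open Literature.MathematicalPhysics.QuantumFieldTheory
open Literature.MathematicalPhysics.QuantumFieldTheory.Balaban1983to89
open Literature.MathematicalPhysics.QuantumFieldTheory.Balaban1983to89.Beta
open B12Sec2to5 (l1 l1_nonneg)
open ExpKernelCalculus (Site MKer comp Decays BiLoc summable_exp_shift')
open OneStepResolventKernel (Fib LocStencil)
open OneStepKernelFamily (KInvStep vertexOfK decays_KInvStep)
open SecondOrderResponse (dM vertexOfM)
open StepJetData (wilsonA locStencil_wilsonA locStencil_smul)
open AffineAveraging (box toSite)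
open AveragingHessianKernels (ell)
open AveragingHessianKernelsRooted (vhSAt locStencil_vhSAt)
open Summit.QuantumFields.BalabanUV.Beta.TameKernelCalculus (Loc Spr Tame comp_add_left_tame comp_add_right_tame)
open Summit.QuantumFields.BalabanUV.Beta.AxialDressingRooted (coDressKBmAt decays_coDressKBmAt)
open Summit.QuantumFields.BalabanUV.Beta.HessKerDressedUnits (unitK unitS decays_unitK locStencil_unitS)
open Summit.QuantumFields.BalabanUV.Beta.ChartConjugationReflection (vertexOfK_add)
open Summit.QuantumFields.BalabanUV.Beta.SpineRooted (SpureRecAt SpureRecAt_zero_level)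
open Summit.QuantumFields.BalabanUV.Beta.GAN24.StencilSlotOfShapes (unitS_add)

namespace Summit.QuantumFields.BalabanUV.Beta.GAN24.TwoFaceWordAdditive

variable {d : ℕ}

/-! ## §1 Face-weighted pair families of localised kernels -/

section Pair

variable {ρ₁ ρ₂ : Site (d + 1) → ℝ}

/-- [folklore] The face-weighted pair family of a bi-localised kernel is summable (`|ρ| ≤ 1`). -/
theorem summable_twoFace_of_biLoc {M : MKer (d + 1) (Fib d)} {p q : Site (d + 1)} {C δ : ℝ} (hM : BiLoc M p q C δ) (hδ : 0 < δ)
    (h₁ : ∀ y, |ρ₁ y| ≤ 1) (h₂ : ∀ w, |ρ₂ w| ≤ 1) (a b : Fib d) :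
    Summable fun yw : Site (d + 1) × Site (d + 1) => ρ₁ yw.1 * ρ₂ yw.2 * M yw.1 yw.2 a b := by
  have hC : 0 ≤ C := hM.nonneg a
  have hB : Summable fun yw : Site (d + 1) × Site (d + 1) => (C * Real.exp (-δ * l1 (yw.1 - p))) * Real.exp (-δ * l1 (yw.2 - q)) :=
    Summable.mul_of_nonneg ((summable_exp_shift' hδ p).mul_left C) (summable_exp_shift' hδ q) (fun y => by positivity) (fun w => (Real.exp_pos _).le)
  refine Summable.of_norm_bounded hB (fun yw => ?_)
  rw [Real.norm_eq_abs, abs_mul, abs_mul]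
  have h := hM yw.1 yw.2 a b
  rw [mul_add, Real.exp_add, ← mul_assoc] at h
  calc |ρ₁ yw.1| * |ρ₂ yw.2| * |M yw.1 yw.2 a b| ≤ 1 * 1 * (C * Real.exp (-δ * l1 (yw.1 - p)) * Real.exp (-δ * l1 (yw.2 - q))) :=
        mul_le_mul (mul_le_mul (h₁ yw.1) (h₂ yw.2) (abs_nonneg _) zero_le_one) h (abs_nonneg _) (by positivity)
    _ = _ := by ring

/-- [folklore] The face-weighted pair family of a localised kernel (an5's `Loc`) is summable. -/
theorem summable_twoFace_of_loc {M : MKer (d + 1) (Fib d)} (hM : Loc M) (h₁ : ∀ y, |ρ₁ y| ≤ 1) (h₂ : ∀ w, |ρ₂ w| ≤ 1) (a b : Fib d) :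
    Summable fun yw : Site (d + 1) × Site (d + 1) => ρ₁ yw.1 * ρ₂ yw.2 * M yw.1 yw.2 a b := by
  obtain ⟨p, q, C, δ, hδ, hMb⟩ := hM
  exact summable_twoFace_of_biLoc hMb hδ h₁ h₂ a b

/-- [folklore] **THE TWO-FACE PAIR SUM IS ADDITIVE** on localised kernels. -/
theorem tsum_twoFace_add {M₁ M₂ : MKer (d + 1) (Fib d)} (hM₁ : Loc M₁) (hM₂ : Loc M₂) (h₁ : ∀ y, |ρ₁ y| ≤ 1) (h₂ : ∀ w, |ρ₂ w| ≤ 1) (a b : Fib d) :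
    ∑' yw : Site (d + 1) × Site (d + 1), ρ₁ yw.1 * ρ₂ yw.2 * (M₁ + M₂) yw.1 yw.2 a b =
      (∑' yw : Site (d + 1) × Site (d + 1), ρ₁ yw.1 * ρ₂ yw.2 * M₁ yw.1 yw.2 a b) + ∑' yw : Site (d + 1) × Site (d + 1), ρ₁ yw.1 * ρ₂ yw.2 * M₂ yw.1 yw.2 a b := by
  rw [← (summable_twoFace_of_loc hM₁ h₁ h₂ a b).tsum_add (summable_twoFace_of_loc hM₂ h₁ h₂ a b)]
  exact tsum_congr fun yw => by simp only [Pi.add_apply]; ring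

/-- [folklore] … and compatible with subtraction. -/
theorem tsum_twoFace_sub {M₁ M₂ : MKer (d + 1) (Fib d)} (hM₁ : Loc M₁) (hM₂ : Loc M₂) (h₁ : ∀ y, |ρ₁ y| ≤ 1) (h₂ : ∀ w, |ρ₂ w| ≤ 1) (a b : Fib d) :
    ∑' yw : Site (d + 1) × Site (d + 1), ρ₁ yw.1 * ρ₂ yw.2 * (M₁ - M₂) yw.1 yw.2 a b =
      (∑' yw : Site (d + 1) × Site (d + 1), ρ₁ yw.1 * ρ₂ yw.2 * M₁ yw.1 yw.2 a b) - ∑' yw : Site (d + 1) × Site (d + 1), ρ₁ yw.1 * ρ₂ yw.2 * M₂ yw.1 yw.2 a b := by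
  rw [← (summable_twoFace_of_loc hM₁ h₁ h₂ a b).tsum_sub (summable_twoFace_of_loc hM₂ h₁ h₂ a b)]
  exact tsum_congr fun yw => by simp only [Pi.sub_apply]; ring

/-- [folklore] … and with negation (no hypothesis). -/
theorem tsum_twoFace_neg (M : MKer (d + 1) (Fib d)) (ρ₁ ρ₂ : Site (d + 1) → ℝ) (a b : Fib d) :
    ∑' yw : Site (d + 1) × Site (d + 1), ρ₁ yw.1 * ρ₂ yw.2 * (-M) yw.1 yw.2 a b = -∑' yw : Site (d + 1) × Site (d + 1), ρ₁ yw.1 * ρ₂ yw.2 * M yw.1 yw.2 a b := by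
  rw [← tsum_neg]
  exact tsum_congr fun yw => by simp only [Pi.neg_apply]; ring

end Pair

/-! ## §2 The two-face word is additive in each slot -/

section Word

variable {ρ₁ ρ₂ : Site (d + 1) → ℝ} {A B C X : MKer (d + 1) (Fib d)}

/-- [folklore] **LEFT-SLOT ADDITIVITY**: `FF[((A + B) ∘ X) ∘ C] = FF[(A ∘ X) ∘ C] + FF[(B ∘ X) ∘ C]` for localised `A B C` and a spread `X` (an5's `comp_add_left_tame` twice; the two summand
words are localised, so the pair sum splits). -/
theorem twoFace_word_add_left (hA : Loc A) (hB : Loc B) (hX : Spr X) (hC : Loc C) (h₁ : ∀ y, |ρ₁ y| ≤ 1) (h₂ : ∀ w, |ρ₂ w| ≤ 1) (a b : Fib d) :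
    ∑' yw : Site (d + 1) × Site (d + 1), ρ₁ yw.1 * ρ₂ yw.2 * comp (comp (A + B) X) C yw.1 yw.2 a b =
      (∑' yw : Site (d + 1) × Site (d + 1), ρ₁ yw.1 * ρ₂ yw.2 * comp (comp A X) C yw.1 yw.2 a b) +
        ∑' yw : Site (d + 1) × Site (d + 1), ρ₁ yw.1 * ρ₂ yw.2 * comp (comp B X) C yw.1 yw.2 a b := by
  rw [comp_add_left_tame hA.tame hB.tame hX.tame, comp_add_left_tame (hA.comp_spr hX).tame (hB.comp_spr hX).tame hC.tame]
  exact tsum_twoFace_add ((hA.comp_spr hX).comp hC) ((hB.comp_spr hX).comp hC) h₁ h₂ a b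

/-- [folklore] **RIGHT-SLOT ADDITIVITY**: `FF[(A ∘ X) ∘ (B + C)] = FF[(A ∘ X) ∘ B] + FF[(A ∘ X) ∘ C]`. -/
theorem twoFace_word_add_right (hA : Loc A) (hX : Spr X) (hB : Loc B) (hC : Loc C) (h₁ : ∀ y, |ρ₁ y| ≤ 1) (h₂ : ∀ w, |ρ₂ w| ≤ 1) (a b : Fib d) :
    ∑' yw : Site (d + 1) × Site (d + 1), ρ₁ yw.1 * ρ₂ yw.2 * comp (comp A X) (B + C) yw.1 yw.2 a b =
      (∑' yw : Site (d + 1) × Site (d + 1), ρ₁ yw.1 * ρ₂ yw.2 * comp (comp A X) B yw.1 yw.2 a b) +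
        ∑' yw : Site (d + 1) × Site (d + 1), ρ₁ yw.1 * ρ₂ yw.2 * comp (comp A X) C yw.1 yw.2 a b := by
  rw [comp_add_right_tame (hA.comp_spr hX).tame hB.tame hC.tame]
  exact tsum_twoFace_add ((hA.comp_spr hX).comp hB) ((hA.comp_spr hX).comp hC) h₁ h₂ a b

end Word

/-! ## §3 The background derivative of the dressed level-0 operator splits into its three half-vertices -/

section Split

variable {N : ℕ}

/-- [folklore] A local stencil family in units is uniformly bounded (`LocStencil` at any rate, `e^{−δ(…)} ≤ 1`). -/
theorem abs_unitS_le_of_locStencil (sf sm : ℝ) {S : Fin (d + 1) → Site (d + 1) → MKer (d + 1) (Fib d)} {Cs δs : ℝ} (hS : LocStencil S Cs δs) (hδs : 0 ≤ δs)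
    (κ' : Fin (d + 1)) (u x z : Site (d + 1)) (a b : Fib d) :
    |unitS sf sm S κ' u x z a b| ≤ |(sf * sm)⁻¹| * (max |sf⁻¹| |sm⁻¹| * Cs * max |sf⁻¹| |sm⁻¹|) := by
  have h := locStencil_unitS (sf := sf) (sm := sm) hS κ' u x z a b
  have hC : 0 ≤ |(sf * sm)⁻¹| * (max |sf⁻¹| |sm⁻¹| * Cs * max |sf⁻¹| |sm⁻¹|) := (locStencil_unitS (sf := sf) (sm := sm) hS κ' u).nonneg a
  exact h.trans (mul_le_of_le_one_right hC (Real.exp_le_one_iff.2 (by nlinarith [l1_nonneg (x - u), l1_nonneg (z - u)])))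

/-- [folklore] **`dM` SPLITS OVER A SUM OF STENCIL TABLES IN UNITS**: for a decaying `K` and local stencil families `S T`,
`dM K N (unitS s_f s_m (S + T)) M μ y = vertexOfK K N (unitS s_f s_m S) μ y + dM K N (unitS s_f s_m T) M μ y` (`unitS_add`, `vertexOfK_add`). -/
theorem dM_unitS_add {K : MKer (d + 1) (Fib d)} {CK δK : ℝ} (hK : Decays K CK δK) (hδK : 0 < δK) (sf sm : ℝ)
    {S T : Fin (d + 1) → Site (d + 1) → MKer (d + 1) (Fib d)} {Cs δs Ct δt : ℝ} (hS : LocStencil S Cs δs) (hδs : 0 ≤ δs) (hT : LocStencil T Ct δt) (hδt : 0 ≤ δt)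
    (M : Fin (d + 1) → Site (d + 1) → MKer (d + 1) (Fib d)) (μ : Fin (d + 1)) (y : Site (d + 1)) :
    dM K N (unitS sf sm (fun κ u => S κ u + T κ u)) M μ y = vertexOfK K N (unitS sf sm S) μ y + dM K N (unitS sf sm T) M μ y := by
  have hKd : ∃ δ C : ℝ, 0 < δ ∧ 0 ≤ C ∧ Decays K C δ := ⟨δK, CK, hδK, hK.nonneg (Sum.inl 0), hK⟩
  set B : ℝ := max (|(sf * sm)⁻¹| * (max |sf⁻¹| |sm⁻¹| * Cs * max |sf⁻¹| |sm⁻¹|)) (|(sf * sm)⁻¹| * (max |sf⁻¹| |sm⁻¹| * Ct * max |sf⁻¹| |sm⁻¹|)) with hB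
  have hSb : ∀ κ' u x z a b, |unitS sf sm S κ' u x z a b| ≤ B := fun κ' u x z a b => (abs_unitS_le_of_locStencil sf sm hS hδs κ' u x z a b).trans (le_max_left _ _)
  have hTb : ∀ κ' u x z a b, |unitS sf sm T κ' u x z a b| ≤ B := fun κ' u x z a b => (abs_unitS_le_of_locStencil sf sm hT hδt κ' u x z a b).trans (le_max_right _ _)
  unfold SecondOrderResponse.dM
  rw [unitS_add, vertexOfK_add (N := N) hKd hSb hTb μ y, add_assoc]

variable {Lc : ℕ} [NeZero Lc] {r : Fin (d + 1) → ℕ}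

/-- [folklore] **THE BACKGROUND DERIVATIVE OF THE DRESSED LEVEL-0 OPERATOR SPLITS INTO ITS WILSON, BORDER AND MULTIPLIER HALF-VERTICES** (in-block root `ρ = toSite r`, `1 ≤ Lc`,
all units, any colour constants, ANY multiplier table `M`): with `X̃♮_0 = unitK s_f s_m (coDressKBmAt ρ Lc (KInvStep Lc 0))` and `S♮_0 = unitS s_f s_m (SpureRecAt d Lc ρ cE cVH cΛ 0)`
(`= unitS (cE • wilsonA + cVH • vhSAt ρ)`, `SpureRecAt_zero_level`),
`dM X̃♮_0 Lc S♮_0 M μ u = vertexOfK X̃♮_0 Lc (unitS (cE • wilsonA)) μ u + (vertexOfK X̃♮_0 Lc (unitS (cVH • vhSAt ρ)) μ u + vertexOfM X̃♮_0 Lc M μ u)`. -/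
theorem dM_dressed_level0_split (hLc : 1 ≤ Lc) (hr : r ∈ box (d + 1) Lc) (sf sm cE cVH cΛ : ℝ) (M : Fin (d + 1) → Site (d + 1) → MKer (d + 1) (Fib d))
    (μ : Fin (d + 1)) (u : Site (d + 1)) :
    dM (unitK sf sm (coDressKBmAt (toSite r) Lc (KInvStep (d := d) Lc 0))) Lc (unitS sf sm (SpureRecAt d Lc (toSite r) cE cVH cΛ 0)) M μ u =
      vertexOfK (unitK sf sm (coDressKBmAt (toSite r) Lc (KInvStep (d := d) Lc 0))) Lc (unitS sf sm (fun κ v => cE • wilsonA d κ v)) μ u +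
        (vertexOfK (unitK sf sm (coDressKBmAt (toSite r) Lc (KInvStep (d := d) Lc 0))) Lc (unitS sf sm (fun κ v => cVH • vhSAt (toSite r) d Lc rfl κ v)) μ u +
          vertexOfM (unitK sf sm (coDressKBmAt (toSite r) Lc (KInvStep (d := d) Lc 0))) Lc M μ u) := by
  obtain ⟨δK, CK, hδK, hCK, hXd⟩ := decays_coDressKBmAt hLc hr (decays_KInvStep (d := d) (Lc := Lc) 0)
  have hXu := decays_unitK (sf := sf) (sm := sm) hXd
  have hSE := locStencil_smul cE (locStencil_wilsonA (d := d) le_rfl)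
  have hSV := locStencil_smul cVH (locStencil_vhSAt hLc hr le_rfl)
  rw [SpureRecAt_zero_level, dM_unitS_add (N := Lc) hXu hδK sf sm hSE le_rfl hSV le_rfl M μ u]
  rfl

end Split

end Summit.QuantumFields.BalabanUV.Beta.GAN24.TwoFaceWordAdditive

end
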